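import Summits.Schanuel.Schanuel.Theorems.RootDecomp1KFiniteOrderCell01

/-!
# RootDecomp1KFiniteOrderCell — lens 1, generation 33 «33364 FIRST CELL» (RootDecomp1KFiniteOrderCell.lean 7ddcd064…, 1378 l) — continuation (RootDecomp1KFiniteOrderCell02): §3 exponential Liouville order pinned: `liouvilleOrder_towerNumber` (order c − 1 holds), `not_liouvilleOrder_towerNumber` (order c + 1 fails), `not_hyperLiouville_towerNumber`, `towerNumber_pinned`

(lens-1 g33 `RootDecomp1KFiniteOrderCell.lean`, sha256 7ddcd064f55911e6…, farm rc 0 · 0 warn · 0 sorry · axioms std; critic VERDICT STATUS L1611: ONE cell-decision credit «33364 FIRST CELL» (K-R15), PORT GO LOW census lane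
`--supports stmt-Schanuel-33364`; port by census-1 gen 14 in four parts RootDecomp1KFiniteOrderCell01–04 (§1 = the verbatim copy of the g32 engine DELETED, engine imported from the landed `RootDecomp1PowerLineOrder02`;
`set_option linter.*` dropped; 14 one-line docstrings added); statements and proofs verbatim; binders hNW1 / hNW by name. Nothing here proves Schanuel; rung 0.)
-/

noncomputable section

open Complex IntermediateField Filter Polynomial

namespace Summit.Schanuel.Schanuel.Theorems.RootDecomp1KFiniteOrderCell

open Summit.Schanuel.Schanuel.Theorems.RootDecomp1KHyper
open Summit.Schanuel.Schanuel.Theorems.RootDecomp1KHyper.HyperCell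
open Summit.Schanuel.Schanuel.Theorems.RootDecomp1KGeneric (LiouvilleOrder LogSqLiouville)
open Literature.NumberTheory.Transcendental (NesterenkoWaldschmidt1996_thm_5_1 NesterenkoWaldschmidt1996_thm_1)
open Summit.Schanuel.Schanuel.Theorems.RootDecomp1PowerLineLadder (sb_momentCurve_of_liouvilleOrder)

variable {n K : ℕ}

/-! ## §3  Exponential Liouville order pinned: order `c − 1` holds, order `c + 1` fails -/

/-- `2 · 16^{−Y} < 3^{−Y}` for `Y ≥ 1` (lens 6). -/
private theorem two_mul_sixteenth_pow_lt' {Y : ℕ} (hY : 1 ≤ Y) :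
    2 * ((1 : ℝ) / 16) ^ Y < ((1 : ℝ) / 3) ^ Y := by
  have e : ((1 : ℝ) / 3) ^ Y = ((16 : ℝ) / 3) ^ Y * ((1 : ℝ) / 16) ^ Y := by
    rw [← mul_pow]; norm_num
  rw [e]
  have h : (2 : ℝ) < ((16 : ℝ) / 3) ^ Y :=
    calc (2 : ℝ) < 16 / 3 := by norm_num
      _ ≤ ((16 : ℝ) / 3) ^ Y := le_self_pow₀ (by norm_num) (by omega)
  exact mul_lt_mul_of_pos_right h (by positivity)

/-- `e ≤ 3`. -/
private theorem exp_one_le_three' : Real.exp 1 ≤ 3 := by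
  have := Real.exp_one_lt_d9; norm_num at this; linarith

/-- `(1/3)^Y ≤ exp(−Y)` (lens 6). -/
private theorem third_pow_le_exp_neg' (Y : ℕ) : ((1 : ℝ) / 3) ^ Y ≤ Real.exp (-(Y : ℝ)) := by
  have h1 : (1 : ℝ) / 3 ≤ Real.exp (-1) := by
    rw [Real.exp_neg, ← one_div]
    exact one_div_le_one_div_of_le (Real.exp_pos 1) exp_one_le_three'
  calc ((1 : ℝ) / 3) ^ Y ≤ Real.exp (-1) ^ Y := pow_le_pow_left₀ (by norm_num) h1 Y
    _ = Real.exp (-(Y : ℝ)) := by rw [← Real.exp_nat_mul]; ring_nf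

/-- **`T_{k+1}` has exponential Liouville order `k`** — the truncations `M/2^{a_K}` approximate to within
`2·2^{−a_{K+1}} = 2·2^{−(2^{a_K})^{k+1}} < exp(−(2^{a_K})^k)`. -/
theorem liouvilleOrder_towerNumber (k : ℕ) : LiouvilleOrder k (towerNumber (k + 1)) := by
  have hc : 1 ≤ k + 1 := by omega
  intro N
  -- the approximant: the truncation with `N + 2` terms, denominator `2^{a_{N+1}}`
  obtain ⟨r, hden, hrR⟩ := towerNumber_truncation hc (N + 1)
  set A : ℕ := texp (k + 1) (N + 1) with hA
  have hA2 : 2 ≤ A := by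
    have := succ_le_texp hc (N + 1); omega
  set T : ℝ := ∑' j, 1 / (2 : ℝ) ^ texp (k + 1) (j + (N + 2)) with hT
  have hlam : towerNumber (k + 1) - r = T := by
    rw [hrR, towerNumber_eq_partialSum_add_tail hc (N + 2)]; ring
  have hTpos : 0 < T := towerNumber_tail_pos hc (N + 2)
  have hTle : T ≤ 2 * (1 / (2 : ℝ) ^ texp (k + 1) (N + 2)) := towerNumber_tail_le hc (N + 2)
  refine ⟨r, ?_, ?_, ?_⟩
  · -- `N ≤ den r = 2^A`
    rw [hden]
    calc N ≤ N + 2 := by omega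
      _ ≤ A := succ_le_texp hc (N + 1)
      _ ≤ 2 ^ A := Nat.lt_two_pow_self.le
  · intro h
    have : towerNumber (k + 1) - r = 0 := by rw [h, sub_self]
    rw [hlam] at this
    exact hTpos.ne' this
  · rw [hlam, abs_of_pos hTpos, hden]
    -- `den^k = 2^{kA} =: Y`, `a_{N+2} = 2^{(k+1)A} = 2^A · Y ≥ 4X`
    set Y : ℕ := 2 ^ (k * A) with hY
    have hY1 : 1 ≤ Y := Nat.one_le_two_pow
    have hcast : (((2 ^ A : ℕ) : ℝ)) ^ k = (Y : ℝ) := by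
      rw [hY]; push_cast; rw [← pow_mul, Nat.mul_comm]
    rw [hcast]
    have h4Y : 4 * Y ≤ texp (k + 1) (N + 2) := by
      rw [texp_succ, hY, ← hA]
      have e : (k + 1) * A = k * A + A := by ring
      rw [e, pow_add]
      have h4 : 4 ≤ 2 ^ A := by
        calc 4 = 2 ^ 2 := by norm_num
          _ ≤ 2 ^ A := Nat.pow_le_pow_right (by norm_num) hA2
      calc 4 * 2 ^ (k * A) = 2 ^ (k * A) * 4 := by ring
        _ ≤ 2 ^ (k * A) * 2 ^ A := Nat.mul_le_mul_left _ h4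
    calc T ≤ 2 * (1 / (2 : ℝ) ^ texp (k + 1) (N + 2)) := hTle
      _ ≤ 2 * (1 / (2 : ℝ) ^ (4 * Y)) := by
          gcongr
          · norm_num
      _ = 2 * ((1 : ℝ) / 16) ^ Y := by
          rw [pow_mul, one_div_pow]; norm_num
      _ < ((1 : ℝ) / 3) ^ Y := two_mul_sixteenth_pow_lt' hY1
      _ ≤ Real.exp (-(Y : ℝ)) := third_pow_le_exp_neg' Y

/-- Hence `T_c` is Liouville, irrational, nonzero, transcendental (`c ≥ 4`, i.e. order `≥ 3`). -/
theorem liouville_towerNumber {c : ℕ} (hc : 4 ≤ c) : Liouville (towerNumber c) := by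
  obtain ⟨k, rfl⟩ : ∃ k, c = k + 1 := ⟨c - 1, by omega⟩
  exact (liouvilleOrder_towerNumber k).liouville (by omega)

/-- `4·Q² ≤ 2^Q` for `Q ≥ 16`. -/
private theorem four_mul_sq_le_two_pow {Q : ℕ} (hQ : 16 ≤ Q) : 4 * Q ^ 2 ≤ 2 ^ Q := by
  induction Q, hQ using Nat.le_induction with
  | base => norm_num
  | succ Q hQ ih =>
      have h1 : 4 * (Q + 1) ^ 2 ≤ 2 * (4 * Q ^ 2) := by nlinarith
      calc 4 * (Q + 1) ^ 2 ≤ 2 * (4 * Q ^ 2) := h1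
        _ ≤ 2 * 2 ^ Q := Nat.mul_le_mul_left 2 ih
        _ = 2 ^ (Q + 1) := by rw [pow_succ]; ring

/-- **EFFECTIVE IRRATIONALITY MEASURE OF `T_c`** (`c ≥ 2`): for every rational `r` of denominator
`q ≥ 2`, `|T_c − r| ≥ 1 / (2q · 2^{q^c})`.  Proof: with `Q_j = 2^{a_j} ≤ q < Q_{j+1}`, the truncation
`s_{j+1}` has denominator `Q_{j+1} ≠ q`, so `|r − s_{j+1}| ≥ 1/(q Q_{j+1})`, while
`|T_c − s_{j+1}| ≤ 2/Q_{j+2} ≤ 1/(2 q Q_{j+1})`; and `Q_{j+1} = 2^{Q_j^c} ≤ 2^{q^c}`. -/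
theorem towerNumber_sub_rat_lower {c : ℕ} (hc : 2 ≤ c) (r : ℚ) (hq : 2 ≤ r.den) :
    1 / (2 * (r.den : ℝ) * (2 : ℝ) ^ (r.den ^ c)) ≤ |towerNumber c - r| := by
  classical
  have hc1 : 1 ≤ c := by omega
  set q : ℕ := r.den with hqdef
  have hq0R : (0 : ℝ) < q := by exact_mod_cast (show 0 < q by omega)
  -- `j` minimal with `q < Q_{j+1} = 2^{a_{j+1}}`; then `Q_j ≤ q`
  have hex : ∃ j : ℕ, q < 2 ^ texp c (j + 1) :=
    ⟨q, lt_of_lt_of_le Nat.lt_two_pow_self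
      (Nat.pow_le_pow_right (by norm_num) ((Nat.le_succ q).trans
        ((succ_le_texp hc1 q).trans (texp_lt_succ hc1 q).le)))⟩
  set j : ℕ := Nat.find hex with hj
  have hjP : q < 2 ^ texp c (j + 1) := Nat.find_spec hex
  have hjlow : 2 ^ texp c j ≤ q := by
    rcases Nat.eq_zero_or_pos j with hj0 | hjpos
    · rw [hj0, texp_zero, pow_one]; exact hq
    · have h := Nat.find_min hex (m := j - 1) (by omega)
      rw [Nat.sub_add_cancel hjpos] at h
      exact not_lt.mp h
  -- names: `Q = Q_{j+1}`, `a₂ = a_{j+2}`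
  set Q : ℕ := 2 ^ texp c (j + 1) with hQdef
  have hQ16 : 16 ≤ Q := by
    have h4 : 4 ≤ texp c (j + 1) := by
      rw [texp_succ]
      calc 4 = 2 ^ 2 := by norm_num
        _ ≤ 2 ^ (c * texp c j) :=
            Nat.pow_le_pow_right (by norm_num) (by nlinarith [one_le_texp c j])
    calc 16 = 2 ^ 4 := by norm_num
      _ ≤ Q := Nat.pow_le_pow_right (by norm_num) h4
  have hQ0R : (0 : ℝ) < Q := by exact_mod_cast (show 0 < Q by omega)
  have hqQ : q < Q := hjP
  -- the truncation `s = s_{j+1}` (denominator `Q`) and the tail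
  obtain ⟨s, hsden, hsR⟩ := towerNumber_truncation hc1 (j + 1)
  set T : ℝ := ∑' k, 1 / (2 : ℝ) ^ texp c (k + (j + 2)) with hT
  have hℓ : towerNumber c = (s : ℝ) + T := by
    rw [hsR, towerNumber_eq_partialSum_add_tail hc1 (j + 2)]
  have hTpos : 0 < T := towerNumber_tail_pos hc1 (j + 2)
  -- `r ≠ s` (different denominators)
  have hrs : r ≠ s := by
    intro h; rw [h, hsden] at hqdef; omega
  -- `|r − s| ≥ 1/(qQ)`
  have hsep : 1 / ((q : ℝ) * Q) ≤ |(r : ℝ) - s| := by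
    have hne : r - s ≠ 0 := sub_ne_zero.mpr hrs
    have h1 : ((r - s : ℚ) : ℝ) = ((r - s).num : ℝ) / ((r - s).den : ℝ) := by
      exact_mod_cast ((r - s).num_div_den).symm
    have hnum : (1 : ℝ) ≤ |((r - s).num : ℝ)| := by
      have : (r - s).num ≠ 0 := Rat.num_ne_zero.mpr hne
      exact_mod_cast Int.one_le_abs this
    have hdendvd : (r - s).den ∣ q * Q := by
      rw [hqdef, hQdef, ← hsden]
      exact Rat.sub_den_dvd r s
    have hdenle : ((r - s).den : ℝ) ≤ (q : ℝ) * Q := by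
      have := Nat.le_of_dvd (by positivity) hdendvd
      exact_mod_cast this
    have hdenpos : (0 : ℝ) < (r - s).den := by exact_mod_cast (r - s).den_pos
    rw [show (r : ℝ) - s = ((r - s : ℚ) : ℝ) by push_cast; ring, h1, abs_div,
      abs_of_pos hdenpos]
    calc 1 / ((q : ℝ) * Q) ≤ 1 / ((r - s).den : ℝ) :=
          one_div_le_one_div_of_le hdenpos hdenle
      _ ≤ |((r - s).num : ℝ)| / ((r - s).den : ℝ) :=
          div_le_div_of_nonneg_right hnum hdenpos.le
  -- the tail: `T ≤ 2/2^{a_{j+2}} ≤ 2/2^Q ≤ 1/(2 q Q)`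
  have hTle : T ≤ 1 / (2 * ((q : ℝ) * Q)) := by
    have h1 : T ≤ 2 * (1 / (2 : ℝ) ^ texp c (j + 2)) := towerNumber_tail_le hc1 (j + 2)
    have h2 : Q ≤ texp c (j + 2) := by
      rw [texp_succ, hQdef]
      exact Nat.pow_le_pow_right (by norm_num) (Nat.le_mul_of_pos_left _ (by omega))
    have h3 : 2 * (1 / (2 : ℝ) ^ texp c (j + 2)) ≤ 2 * (1 / (2 : ℝ) ^ Q) := by
      gcongr; norm_num
    have h4 : (4 : ℝ) * Q ^ 2 ≤ (2 : ℝ) ^ Q := by exact_mod_cast four_mul_sq_le_two_pow hQ16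
    have h5 : 2 * (1 / (2 : ℝ) ^ Q) ≤ 1 / (2 * ((q : ℝ) * Q)) := by
      rw [mul_one_div, div_le_div_iff₀ (by positivity) (by positivity)]
      have hqQR : (q : ℝ) ≤ Q := by exact_mod_cast hqQ.le
      nlinarith [hqQR, hQ0R, hq0R]
    linarith
  -- `|T_c − r| ≥ |r − s| − T ≥ 1/(2qQ)`
  have htri : |(r : ℝ) - s| - T ≤ |towerNumber c - r| := by
    rw [hℓ]
    have e : (s : ℝ) + T - r = T - ((r : ℝ) - s) := by ring
    rw [e, abs_sub_comm T ((r : ℝ) - s)]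
    have h1 := abs_sub_abs_le_abs_sub ((r : ℝ) - s) T
    rw [abs_of_pos hTpos] at h1
    exact h1
  -- `Q = 2^{a_{j+1}} = 2^{Q_j^c} ≤ 2^{q^c}`
  have hQle : (Q : ℝ) ≤ (2 : ℝ) ^ (q ^ c) := by
    have h1 : texp c (j + 1) ≤ q ^ c := by
      rw [texp_succ_eq_pow]
      exact Nat.pow_le_pow_left hjlow c
    have h2 : Q ≤ 2 ^ (q ^ c) := Nat.pow_le_pow_right (by norm_num) h1
    exact_mod_cast h2
  calc 1 / (2 * (q : ℝ) * (2 : ℝ) ^ (q ^ c)) ≤ 1 / (2 * ((q : ℝ) * Q)) := by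
        rw [mul_assoc]
        apply one_div_le_one_div_of_le (by positivity)
        gcongr
    _ = 1 / ((q : ℝ) * Q) - 1 / (2 * ((q : ℝ) * Q)) := by field_simp; ring
    _ ≤ |(r : ℝ) - s| - T := by linarith
    _ ≤ |towerNumber c - r| := htri

/-- `2q ≤ 2^q`. -/
private theorem two_mul_le_two_pow (q : ℕ) : 2 * q ≤ 2 ^ q := by
  induction q with
  | zero => simp
  | succ q ih =>
      rcases Nat.eq_zero_or_pos q with h0 | hpos
      · subst h0; simp
      · calc 2 * (q + 1) = 2 * q + 2 := by ring
          _ ≤ 2 ^ q + 2 ^ q := by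
              have : 2 ≤ 2 ^ q := by
                calc 2 = 2 ^ 1 := by norm_num
                  _ ≤ 2 ^ q := Nat.pow_le_pow_right (by norm_num) hpos
              omega
          _ = 2 ^ (q + 1) := by rw [pow_succ]; ring

/-- `exp(−q^{c+1}) ≤ 1/(2q · 2^{q^c})` for `q ≥ 2`, `c ≥ 1`. -/
private theorem exp_neg_pow_succ_le {c q : ℕ} (hc : 1 ≤ c) (hq : 2 ≤ q) :
    Real.exp (-((q : ℝ) ^ (c + 1))) ≤ 1 / (2 * (q : ℝ) * (2 : ℝ) ^ (q ^ c)) := by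
  rw [Real.exp_neg, ← one_div]
  apply one_div_le_one_div_of_le (by positivity)
  -- `2q · 2^{q^c} ≤ 2^q · 2^{q^c} = 2^{q + q^c} ≤ 2^{q^{c+1}} ≤ e^{q^{c+1}}`
  have h1 : (2 * (q : ℝ)) ≤ (2 : ℝ) ^ q := by exact_mod_cast two_mul_le_two_pow q
  have h2 : q + q ^ c ≤ q ^ (c + 1) := by
    have hqc : q ≤ q ^ c := by
      calc q = q ^ 1 := (pow_one q).symm
        _ ≤ q ^ c := Nat.pow_le_pow_right (by omega) hc
    calc q + q ^ c ≤ q ^ c + q ^ c := by omega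
      _ = 2 * q ^ c := by ring
      _ ≤ q * q ^ c := Nat.mul_le_mul_right _ hq
      _ = q ^ (c + 1) := by rw [pow_succ]; ring
  have h3 : (2 : ℝ) ^ q * (2 : ℝ) ^ (q ^ c) ≤ (2 : ℝ) ^ (q ^ (c + 1)) := by
    rw [← pow_add]
    exact pow_le_pow_right₀ (by norm_num) h2
  have h4 : (2 : ℝ) ^ (q ^ (c + 1)) ≤ Real.exp ((q : ℝ) ^ (c + 1)) := by
    have h2e : (2 : ℝ) ≤ Real.exp 1 := by linarith [Real.add_one_le_exp (1 : ℝ)]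
    calc (2 : ℝ) ^ (q ^ (c + 1)) ≤ (Real.exp 1) ^ (q ^ (c + 1)) :=
          pow_le_pow_left₀ (by norm_num) h2e _
      _ = Real.exp ((q : ℝ) ^ (c + 1)) := by
          rw [← Real.exp_nat_mul]; push_cast; ring_nf
  calc 2 * (q : ℝ) * (2 : ℝ) ^ (q ^ c) ≤ (2 : ℝ) ^ q * (2 : ℝ) ^ (q ^ c) := by
        gcongr
    _ ≤ (2 : ℝ) ^ (q ^ (c + 1)) := h3
    _ ≤ Real.exp ((q : ℝ) ^ (c + 1)) := h4

/-- **`T_c` does NOT have exponential order `c + 1`** (`c ≥ 2`). -/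
theorem not_liouvilleOrder_towerNumber {c : ℕ} (hc : 2 ≤ c) :
    ¬ LiouvilleOrder (c + 1) (towerNumber c) := by
  intro h
  obtain ⟨r, hden, -, hlt⟩ := h 2
  have hlow := towerNumber_sub_rat_lower hc r hden
  have hup := exp_neg_pow_succ_le (c := c) (q := r.den) (by omega) hden
  linarith

/-- **`T_c` is NOT hyper-Liouville** (`c ≥ 2`): an explicit Liouville number of FINITE exponential order. -/
theorem not_hyperLiouville_towerNumber {c : ℕ} (hc : 2 ≤ c) : ¬ HyperLiouville (towerNumber c) :=
  fun h => not_liouvilleOrder_towerNumber hc (LiouvilleOrder.of_hyperLiouville h (c + 1))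

/-- Summary: `T_{k+1}` (`k ≥ 3`) is a Liouville number of exponential order `k` but NOT of order `k + 2`,
hence not hyper-Liouville — a NAMED point of the scope of item 33364 off the scope of item 33363. -/
theorem towerNumber_pinned {k : ℕ} (hk : 3 ≤ k) :
    LiouvilleOrder k (towerNumber (k + 1)) ∧ ¬ LiouvilleOrder (k + 2) (towerNumber (k + 1)) ∧
      Liouville (towerNumber (k + 1)) ∧ ¬ HyperLiouville (towerNumber (k + 1)) :=
  ⟨liouvilleOrder_towerNumber k, not_liouvilleOrder_towerNumber (by omega),
    liouville_towerNumber (by omega), not_hyperLiouville_towerNumber (by omega)⟩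

end Summit.Schanuel.Schanuel.Theorems.RootDecomp1KFiniteOrderCell
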